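import Literature.Analysis.FluidPDE.OnsagerBDSVParameters
import HarnessLib

/-!
# The BDSV scheme: the stage estimates imply the main iterative proposition
# (the "Proof of Proposition 2.1" of §2.6)

Buckmaster–De Lellis–Székelyhidi–Vicol (BDSV), *Onsager's conjecture for admissible weak
solutions*, CPAM 72 (2019) = arXiv:1701.08678, close the proof of their main iterative
proposition (Prop. 2.1 = the named fact `BDSV.mainIteration` of `OnsagerBDSV.lean`) at the end
of §2.6 ("Proof of Proposition 2.1", p. 8 of the arXiv version) from the estimates produced by
the three stages — (2.12), (2.13), (2.18), (2.19), (2.23), (2.24), (2.24c), transcribed as the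
named fact `BDSV.stagesEstimate` of `OnsagerBDSVStages.lean` — by triangle inequalities and the
parameter inequality (2.25). This file proves that implication,
`BDSV.mainIteration_of_stagesEstimate : BDSV.stagesEstimate → BDSV.mainIteration`,
following the printed argument line by line:

* (2.7): `‖v_{q+1}-v_q‖₀ + λ_{q+1}^{-1}‖v_{q+1}-v_q‖₁ ≤ (M/2)δ_{q+1}^{1/2} + C δ_{q+1}^{1/2} ℓ^α + C δ_q^{1/2} λ_q λ_{q+1}^{-1} ≤ M δ_{q+1}^{1/2}`
  for `a` large, writing `v_{q+1} - v_q = (v_{q+1} - v̄_q) + (v̄_q - v_ℓ) + (v_ℓ - v_q)`;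
* (2.4) at `q+1`: `‖v_{q+1}‖₁ ≤ M δ_q^{1/2} λ_q + (M/2) δ_{q+1}^{1/2} λ_{q+1} + … ≤ M δ_{q+1}^{1/2} λ_{q+1}`;
* (2.5) at `q+1`: `‖v_{q+1}‖₀ ≤ 1 - δ_q^{1/2} + M δ_{q+1}^{1/2} ≤ 1 - δ_{q+1}^{1/2}`;
* (2.3) at `q+1` from (2.24) and (2.6) at `q+1` from (2.24c), both via (2.25), which holds for
  `α` small and `a` large by (2.26) and (2.1).

The parameter inequalities are `BDSV.exists_mainThreshold` (`OnsagerBDSVParameters.lean`); the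
threshold `α₀` of Prop. 2.1 is `min(α₀', -E₀/(8b))` with `α₀'` that of the stages and
`E₀ = (2βb - (1-β))(b-1) < 0` the left side of (2.26) at `α = 0`, and `a₀` is the maximum of the
stages' threshold and that of `exists_mainThreshold` (with the constant `max C 1`).

## References

* T. Buckmaster, C. De Lellis, L. Székelyhidi Jr., V. Vicol, *Onsager's conjecture for admissible
  weak solutions*, Comm. Pure Appl. Math. 72 (2019) 229–274 = arXiv:1701.08678, §2.6, "Proof of
  Proposition 2.1", with (2.25)–(2.26).
-/

open MeasureTheory Set
open scoped NNReal ENNReal ContDiff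

noncomputable section

namespace Literature.Analysis.FluidPDE

namespace BDSV

/-! ## Algebra of BDSV's sup-norm bounds -/

section Norms

variable {F : Type*} [NormedAddCommGroup F] {T : ℝ} {f g : ℝ → UnitAddTorus (Fin 3) → F} {B B' : ℝ}

/-- `‖f - g‖₀ ≤ ‖f‖₀ + ‖g‖₀`. [folklore] -/
theorem SupLE.sub (hf : SupLE T f B) (hg : SupLE T g B') :
    SupLE T (fun t x => f t x - g t x) (B + B') := fun t ht x =>
  (norm_sub_le _ _).trans (add_le_add (hf t ht x) (hg t ht x))

/-- A bound `‖f‖₀ ≤ B` on `[0,T] × T³`, `T ≥ 0`, forces `B ≥ 0`. [folklore] -/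
theorem SupLE.nonneg (hf : SupLE T f B) (hT : 0 ≤ T) : 0 ≤ B :=
  (norm_nonneg _).trans (hf 0 ⟨le_rfl, hT⟩ 0)

variable [NormedSpace ℝ F]

/-- A bound `[f]₁ ≤ B` on `[0,T] × T³`, `T ≥ 0`, forces `B ≥ 0`. [folklore] -/
theorem DerivSupLE.nonneg (hf : DerivSupLE T f B) (hT : 0 ≤ T) : 0 ≤ B :=
  (norm_nonneg _).trans (hf 0 0 ⟨le_rfl, hT⟩ 0)

/-- `∂ᵢ(-w) = -∂ᵢw` on `T³` (no regularity needed: `deriv` of a negative). [folklore] -/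
theorem partialDeriv_neg_apply (w : UnitAddTorus (Fin 3) → F) (i : Fin 3) (x : UnitAddTorus (Fin 3)) :
    FunctionSpaces.Torus.partialDeriv i (fun y => -w y) x = -FunctionSpaces.Torus.partialDeriv i w x := by
  simp only [FunctionSpaces.Torus.partialDeriv, FunctionSpaces.Torus.lineDeriv]
  exact deriv.neg

/-- `∂ᵢ(u - w) = ∂ᵢu - ∂ᵢw` for smooth functions on `T³`. [folklore] -/
theorem partialDeriv_sub_of_isSmooth {u w : UnitAddTorus (Fin 3) → F} (hu : FunctionSpaces.Torus.IsSmooth u)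
    (hw : FunctionSpaces.Torus.IsSmooth w) (i : Fin 3) (x : UnitAddTorus (Fin 3)) :
    FunctionSpaces.Torus.partialDeriv i (fun y => u y - w y) x =
      FunctionSpaces.Torus.partialDeriv i u x - FunctionSpaces.Torus.partialDeriv i w x := by
  have h1 : FunctionSpaces.Torus.IsContDiff 1 u := hu.isContDiff (by simp)
  have h2 : FunctionSpaces.Torus.IsContDiff 1 (fun y => -w y) := hw.neg.isContDiff (by simp)
  have hfg : (fun y => u y - w y) = u + fun y => -w y := by
    funext y
    simp [sub_eq_add_neg]
  rw [hfg, FunctionSpaces.Torus.partialDeriv_add h1 h2, Pi.add_apply, partialDeriv_neg_apply,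
    ← sub_eq_add_neg]

end Norms

/-! ## The assembly -/

section Assembly

/-- **The stage estimates imply BDSV's main iterative proposition** (Buckmaster–De Lellis–
Székelyhidi–Vicol 2019, §2.6, "Proof of Proposition 2.1"): given the estimates (2.12), (2.13),
(2.18), (2.19), (2.23), (2.24), (2.24c) of the mollification, gluing and perturbation stages
(`BDSV.stagesEstimate`), Prop. 2.1 (`BDSV.mainIteration`) follows: (2.7) and (2.4), (2.5) at
stage `q+1` by the triangle inequality once `a` is large (absorbing `C δ_{q+1}^{1/2} ℓ^α` and
`C δ_q^{1/2} λ_q λ_{q+1}^{-1}`), and (2.3), (2.6) at stage `q+1` from (2.24), (2.24c) by the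
parameter inequality (2.25), valid for `α` below a threshold depending on `β, b` ((2.26), using
(2.1)) and `a` large. [cite: BuckmasterEtAl2018, §2.6 (Proof of Proposition 2.1)] -/
theorem mainIteration_of_stagesEstimate (h : stagesEstimate) : mainIteration := by
  obtain ⟨M, hM, hstage⟩ := h
  refine ⟨M, hM, fun β hβ hβ3 b hb hbβ => ?_⟩
  obtain ⟨α₀, hα₀, hα⟩ := hstage β hβ hβ3 b hb hbβ
  -- the exponent `E₀ = (2βb - (1-β))(b-1)` of (2.26) at `α = 0` is negative by (2.1)
  have hβ1 : β < 1 := by linarith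
  have h2β : 0 < 2 * β := by linarith
  have h2βb : 2 * β * b < 1 - β := by
    have := (lt_div_iff₀ h2β).1 hbβ
    linarith
  have hb0 : (0 : ℝ) < b := by linarith
  have hE₀neg : (2 * β * b - (1 - β)) * (b - 1) < 0 :=
    mul_neg_of_neg_of_pos (by linarith) (by linarith)
  -- the threshold `α₀` of Prop. 2.1
  refine ⟨min α₀ (-((2 * β * b - (1 - β)) * (b - 1)) / (8 * b)),
    lt_min hα₀ (div_pos (by linarith) (by linarith)), fun α hαpos hαlt => ?_⟩
  have hαlt₀ : α < α₀ := lt_of_lt_of_le hαlt (min_le_left _ _)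
  have hα8 : 8 * α * b < -((2 * β * b - (1 - β)) * (b - 1)) := by
    have h1 : α < -((2 * β * b - (1 - β)) * (b - 1)) / (8 * b) :=
      lt_of_lt_of_le hαlt (min_le_right _ _)
    have h8b : (0 : ℝ) < 8 * b := by linarith
    have := (lt_div_iff₀ h8b).1 h1
    linarith
  obtain ⟨C, a₀, ha₀, hstep⟩ := hα α hαpos hαlt₀
  -- the constant `C' = max C 1` and the threshold `a₀` of Prop. 2.1
  set C' : ℝ := max C 1 with hC'
  have hCC' : C ≤ C' := le_max_left _ _
  have hC'0 : 0 ≤ C' := le_trans zero_le_one (le_max_right _ _)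
  obtain ⟨a₁, ha₁, hthr⟩ := exists_mainThreshold hβ hβ1 hb hαpos hα8 hM C'
  refine ⟨max a₀ a₁, lt_max_of_lt_left ha₀, fun a ha T hT e he q v p R hER hIE => ?_⟩
  have ha0' : a₀ ≤ a := le_of_max_le_left ha
  have ha1' : a₁ ≤ a := le_of_max_le_right ha
  have ha1 : (1 : ℝ) ≤ a := by linarith
  obtain ⟨hU1, hU2, hU3, hU4, hU5, hU6⟩ := hthr a ha1' q
  obtain ⟨vℓ, vbar, v', p', R', hvℓs, hvbars, hER', h12, ⟨bℓ₀, bℓ₁, hℓsup, hℓder, hℓle⟩, h18,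
    ⟨bb₀, bb₁, hbsup, hbder, hble⟩, ⟨B₀', B₁', hsup', hder', hle'⟩, h24, h62⟩ :=
    hstep a ha0' T hT e he q v p R hER hIE
  -- positivity of the parameters
  have hT0 : (0 : ℝ) ≤ T := hT.le
  have hf0 := freq_pos (b := b) ha1 q
  have hf1 := freq_pos (b := b) ha1 (q + 1)
  have hf1' : (1 : ℝ) ≤ freq a b (q + 1) := one_le_freq ha1 (q + 1)
  have hi1 : (0 : ℝ) ≤ (freq a b (q + 1))⁻¹ := inv_nonneg.2 hf1.le
  have hi1' : (freq a b (q + 1))⁻¹ ≤ 1 := inv_le_one_of_one_le₀ hf1'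
  have hs0 : 0 ≤ Real.sqrt (amp β a b q) := Real.sqrt_nonneg _
  have hs1 : 0 ≤ Real.sqrt (amp β a b (q + 1)) := Real.sqrt_nonneg _
  have hA2 : 0 < amp β a b (q + 1 + 1) := amp_pos ha1 _
  have hℓ0 : 0 < mollScale β α a b q := mollScale_pos ha1 q
  have hℓα : mollScale β α a b q ^ α ≤ freq a b q ^ (-α) :=
    mollScale_rpow_le ha1 hb.le hβ.le hαpos.le q
  -- smoothness of the slices of `v_q` and `v_{q+1}`
  have hvs : ∀ t ∈ Icc 0 T, FunctionSpaces.Torus.IsSmooth (v t) := fun t ht =>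
    hER.smooth_velocity.isSmooth_slice ht
  have hv's : ∀ t ∈ Icc 0 T, FunctionSpaces.Torus.IsSmooth (v' t) := fun t ht =>
    hER'.smooth_velocity.isSmooth_slice ht
  -- (2.4) at stage `q`
  obtain ⟨Bq₀, Bq₁, hqsup, hqder, hqle⟩ := hIE.velocity_C1_le
  -- nonnegativity of the bounds
  have hBq₀ : 0 ≤ Bq₀ := hqsup.nonneg hT0
  have hBq₁ : 0 ≤ Bq₁ := hqder.nonneg hT0
  have hbℓ₀ : 0 ≤ bℓ₀ := hℓsup.nonneg hT0
  have hbℓ₁ : 0 ≤ bℓ₁ := hℓder.nonneg hT0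
  have hbb₀ : 0 ≤ bb₀ := hbsup.nonneg hT0
  have hbb₁ : 0 ≤ bb₁ := hbder.nonneg hT0
  have hB₀' : 0 ≤ B₀' := hsup'.nonneg hT0
  have hB₁' : 0 ≤ B₁' := hder'.nonneg hT0
  -- replace the constant `C` by `C' = max C 1 ≥ C`
  have hr0 : 0 ≤ freq a b q ^ (-α) := Real.rpow_nonneg hf0.le _
  have hrℓ : 0 ≤ mollScale β α a b q ^ α := Real.rpow_nonneg hℓ0.le _
  have hr1 : 0 ≤ freq a b (q + 1) ^ (-1 + 4 * α) := Real.rpow_nonneg hf1.le _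
  have hr2 : 0 ≤ freq a b q ^ (1 + 2 * α) := Real.rpow_nonneg hf0.le _
  have h12' : SupLE T (fun t x => vℓ t x - v t x)
      (C' * (Real.sqrt (amp β a b (q + 1)) * freq a b q ^ (-α))) :=
    h12.mono (mul_le_mul_of_nonneg_right hCC' (mul_nonneg hs1 hr0))
  have h18' : SupLE T (fun t x => vbar t x - vℓ t x)
      (C' * (Real.sqrt (amp β a b (q + 1)) * mollScale β α a b q ^ α)) :=
    h18.mono (mul_le_mul_of_nonneg_right hCC' (mul_nonneg hs1 hrℓ))
  have hℓle' : bℓ₀ + bℓ₁ ≤ C' * (Real.sqrt (amp β a b q) * freq a b q) :=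
    hℓle.trans (mul_le_mul_of_nonneg_right hCC' (mul_nonneg hs0 hf0.le))
  have hble' : bb₀ + bb₁ ≤ C' * (Real.sqrt (amp β a b q) * freq a b q) :=
    hble.trans (mul_le_mul_of_nonneg_right hCC' (mul_nonneg hs0 hf0.le))
  have h24' : SupLE T R' (C' * (Real.sqrt (amp β a b (q + 1)) * Real.sqrt (amp β a b q) *
      freq a b q * freq a b (q + 1) ^ (-1 + 4 * α))) :=
    h24.mono (mul_le_mul_of_nonneg_right hCC'
      (mul_nonneg (mul_nonneg (mul_nonneg hs1 hs0) hf0.le) hr1))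
  have h62' : ∀ t ∈ Icc 0 T, |e t - (∫ x, ‖v' t x‖ ^ 2) - amp β a b (q + 1 + 1) / 2| ≤
      C' * (Real.sqrt (amp β a b q) * Real.sqrt (amp β a b (q + 1)) *
        freq a b q ^ (1 + 2 * α) * (freq a b (q + 1))⁻¹) := fun t ht =>
    (h62 t ht).trans (mul_le_mul_of_nonneg_right hCC'
      (mul_nonneg (mul_nonneg (mul_nonneg hs0 hs1) hr2) hi1))
  -- the two small sup bounds (2.18), (2.12): `S₁ ≤ S₂ ≤ (M/16) δ_{q+1}^{1/2}`
  set S₁ : ℝ := C' * (Real.sqrt (amp β a b (q + 1)) * mollScale β α a b q ^ α) with hS₁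
  set S₂ : ℝ := C' * (Real.sqrt (amp β a b (q + 1)) * freq a b q ^ (-α)) with hS₂
  have hS₁0 : 0 ≤ S₁ := mul_nonneg hC'0 (mul_nonneg hs1 hrℓ)
  have hS₁₂ : S₁ ≤ S₂ := mul_le_mul_of_nonneg_left (mul_le_mul_of_nonneg_left hℓα hs1) hC'0
  have hS₂le : S₂ ≤ M / 16 * Real.sqrt (amp β a b (q + 1)) := by
    have := mul_le_mul_of_nonneg_left hU1 hs1
    calc S₂ = Real.sqrt (amp β a b (q + 1)) * (C' * freq a b q ^ (-α)) := by rw [hS₂]; ring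
      _ ≤ Real.sqrt (amp β a b (q + 1)) * (M / 16) := this
      _ = M / 16 * Real.sqrt (amp β a b (q + 1)) := mul_comm _ _
  -- scalar consequences of (2.4), (2.13), (2.19)
  have hBq₁le : Bq₁ ≤ M * Real.sqrt (amp β a b q) * freq a b q := by linarith
  have hbℓ₁le : bℓ₁ ≤ C' * (Real.sqrt (amp β a b q) * freq a b q) := by linarith
  have hbb₁le : bb₁ ≤ C' * (Real.sqrt (amp β a b q) * freq a b q) := by linarith
  have hMsf : 0 ≤ M * (Real.sqrt (amp β a b q) * freq a b q) :=
    mul_nonneg hM.le (mul_nonneg hs0 hf0.le)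
  have hsum : bb₁ + bℓ₁ + bℓ₁ + Bq₁ ≤ (3 * C' + 2 * M) * (Real.sqrt (amp β a b q) * freq a b q) := by
    linarith
  -- the tail `λ_{q+1}^{-1} (3C'+2M) δ_q^{1/2} λ_q ≤ (M/4) δ_{q+1}^{1/2}`
  have htail : (freq a b (q + 1))⁻¹ * (bb₁ + bℓ₁ + bℓ₁ + Bq₁) ≤
      M / 4 * Real.sqrt (amp β a b (q + 1)) := by
    have hd1 := mul_le_mul_of_nonneg_left hsum hi1
    have hd2 := mul_le_mul_of_nonneg_left hU2 hi1
    have hd3 : (freq a b (q + 1))⁻¹ * (M / 4 * (Real.sqrt (amp β a b (q + 1)) * freq a b (q + 1))) =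
        M / 4 * Real.sqrt (amp β a b (q + 1)) := by
      rw [inv_mul_eq_div, div_eq_iff hf1.ne']
      ring
    linarith
  -- the increment `w = v_{q+1} - v_q` and its bounds `B₀ = ‖w‖₀`, `B₁ = [w]₁`
  have hS₂0 : 0 ≤ S₂ := hS₁0.trans hS₁₂
  set B₀ : ℝ := B₀' + S₁ + S₂ with hB₀
  set B₁ : ℝ := B₁' + (bb₁ + bℓ₁) + (bℓ₁ + Bq₁) with hB₁
  have hB₀0 : 0 ≤ B₀ := by rw [hB₀]; linarith
  have hB₁0 : 0 ≤ B₁ := by rw [hB₁]; linarith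
  have hwsup : SupLE T (fun t x => v' t x - v t x) B₀ := by
    intro t ht x
    show ‖v' t x - v t x‖ ≤ B₀
    have e1 : v' t x - v t x = (v' t x - vbar t x) + (vbar t x - vℓ t x) + (vℓ t x - v t x) := by
      abel
    rw [e1]
    exact (norm_add₃_le).trans (add_le_add (add_le_add (hsup' t ht x) (h18' t ht x)) (h12' t ht x))
  have hwder : DerivSupLE T (fun t x => v' t x - v t x) B₁ := by
    intro i t ht x
    show ‖FunctionSpaces.Torus.partialDeriv i (fun y => v' t y - v t y) x‖ ≤ B₁
    have k1 : ‖FunctionSpaces.Torus.partialDeriv i (fun y => v' t y - vbar t y) x‖ ≤ B₁' :=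
      hder' i t ht x
    have k2 := hbder i t ht x
    have k3 := hℓder i t ht x
    have k4 := hqder i t ht x
    rw [partialDeriv_sub_of_isSmooth (hv's t ht) (hvbars t ht)] at k1
    rw [partialDeriv_sub_of_isSmooth (hv's t ht) (hvs t ht)]
    have e1 : FunctionSpaces.Torus.partialDeriv i (v' t) x - FunctionSpaces.Torus.partialDeriv i (v t) x =
        (FunctionSpaces.Torus.partialDeriv i (v' t) x - FunctionSpaces.Torus.partialDeriv i (vbar t) x) +
        (FunctionSpaces.Torus.partialDeriv i (vbar t) x - FunctionSpaces.Torus.partialDeriv i (vℓ t) x) +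
        (FunctionSpaces.Torus.partialDeriv i (vℓ t) x - FunctionSpaces.Torus.partialDeriv i (v t) x) := by
      abel
    rw [e1]
    refine (norm_add₃_le).trans ?_
    have i2 := (norm_sub_le (FunctionSpaces.Torus.partialDeriv i (vbar t) x)
      (FunctionSpaces.Torus.partialDeriv i (vℓ t) x)).trans (add_le_add k2 k3)
    have i3 := (norm_sub_le (FunctionSpaces.Torus.partialDeriv i (vℓ t) x)
      (FunctionSpaces.Torus.partialDeriv i (v t) x)).trans (add_le_add k3 k4)
    linarith
  -- (2.7): `B₀ + λ_{q+1}^{-1} (B₀ + B₁) ≤ M δ_{q+1}^{1/2}`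
  have hmain : B₀ + (freq a b (q + 1))⁻¹ * (B₀ + B₁) ≤ M * Real.sqrt (amp β a b (q + 1)) := by
    have hiS : (freq a b (q + 1))⁻¹ * (S₁ + S₂) ≤ S₁ + S₂ := by
      have hS0 : 0 ≤ S₁ + S₂ := by linarith
      calc (freq a b (q + 1))⁻¹ * (S₁ + S₂) ≤ 1 * (S₁ + S₂) :=
            mul_le_mul_of_nonneg_right hi1' hS0
        _ = S₁ + S₂ := one_mul _
    have e1 : B₀ + (freq a b (q + 1))⁻¹ * (B₀ + B₁) =
        (B₀' + (freq a b (q + 1))⁻¹ * (B₀' + B₁')) + (S₁ + S₂) +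
          (freq a b (q + 1))⁻¹ * (S₁ + S₂) +
          (freq a b (q + 1))⁻¹ * (bb₁ + bℓ₁ + bℓ₁ + Bq₁) := by
      rw [hB₀, hB₁]
      ring
    rw [e1]
    linarith
  have hVI : VelocityIncrementBound M β a b T q (fun t x => v' t x - v t x) :=
    ⟨B₀, B₁, hwsup, hwder, hmain⟩
  -- consequences of (2.7): `‖w‖₀ ≤ M δ_{q+1}^{1/2}` and `B₀' + B₁' ≤ λ_{q+1} (M/2) δ_{q+1}^{1/2}`
  have hB₀le : B₀ ≤ M * Real.sqrt (amp β a b (q + 1)) := by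
    have : 0 ≤ (freq a b (q + 1))⁻¹ * (B₀ + B₁) := mul_nonneg hi1 (add_nonneg hB₀0 hB₁0)
    linarith
  have hB'sum : B₀' + B₁' ≤ freq a b (q + 1) * (M / 2 * Real.sqrt (amp β a b (q + 1))) := by
    have he1 : (freq a b (q + 1))⁻¹ * (B₀' + B₁') ≤ M / 2 * Real.sqrt (amp β a b (q + 1)) := by
      linarith
    calc B₀' + B₁' = freq a b (q + 1) * ((freq a b (q + 1))⁻¹ * (B₀' + B₁')) := by
          rw [← mul_assoc, mul_inv_cancel₀ hf1.ne', one_mul]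
      _ ≤ freq a b (q + 1) * (M / 2 * Real.sqrt (amp β a b (q + 1))) :=
          mul_le_mul_of_nonneg_left he1 hf1.le
  -- the new triple satisfies the inductive estimates at stage `q+1`
  have hIE' : InductiveEstimates M β α a b T e (q + 1) v' R' := by
    refine ⟨h24'.mono hU4, ⟨Bq₀ + B₀, Bq₁ + B₁, ?_, ?_, ?_⟩, ?_, ?_, ?_⟩
    · -- `‖v_{q+1}‖₀ ≤ ‖v_q‖₀ + ‖w‖₀`
      intro t ht x
      have e1 : v' t x = v t x + (v' t x - v t x) := by abel
      rw [e1]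
      exact (norm_add_le _ _).trans (add_le_add (hqsup t ht x) (hwsup t ht x))
    · -- `[v_{q+1}]₁ ≤ [v_q]₁ + [w]₁`
      intro i t ht x
      have k1 := hqder i t ht x
      have k2 : ‖FunctionSpaces.Torus.partialDeriv i (fun y => v' t y - v t y) x‖ ≤ B₁ :=
        hwder i t ht x
      rw [partialDeriv_sub_of_isSmooth (hv's t ht) (hvs t ht)] at k2
      have e1 : FunctionSpaces.Torus.partialDeriv i (v' t) x =
          FunctionSpaces.Torus.partialDeriv i (v t) x +
            (FunctionSpaces.Torus.partialDeriv i (v' t) x - FunctionSpaces.Torus.partialDeriv i (v t) x) := by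
        abel
      rw [e1]
      exact (norm_add_le _ _).trans (add_le_add k1 k2)
    · -- (2.4) at `q+1`: `‖v_{q+1}‖₁ ≤ M δ_{q+1}^{1/2} λ_{q+1}` for `a` large
      have hsf : Real.sqrt (amp β a b (q + 1)) ≤ Real.sqrt (amp β a b (q + 1)) * freq a b (q + 1) :=
        le_mul_of_one_le_right hs1 hf1'
      have hsf' : M / 8 * Real.sqrt (amp β a b (q + 1)) ≤
          M / 8 * (Real.sqrt (amp β a b (q + 1)) * freq a b (q + 1)) :=
        mul_le_mul_of_nonneg_left hsf (by linarith)
      have hS8 : S₁ + S₂ ≤ M / 8 * (Real.sqrt (amp β a b (q + 1)) * freq a b (q + 1)) := by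
        linarith
      have hlow : Bq₀ + Bq₁ + (bb₁ + bℓ₁ + bℓ₁ + Bq₁) ≤
          (3 * C' + 2 * M) * (Real.sqrt (amp β a b q) * freq a b q) := by
        linarith
      have e1 : Bq₀ + B₀ + (Bq₁ + B₁) =
          (B₀' + B₁') + (S₁ + S₂) + (Bq₀ + Bq₁ + (bb₁ + bℓ₁ + bℓ₁ + Bq₁)) := by
        rw [hB₀, hB₁]
        ring
      rw [e1]
      linarith
    · -- (2.5) at `q+1`: `‖v_{q+1}‖₀ ≤ 1 - δ_q^{1/2} + M δ_{q+1}^{1/2} ≤ 1 - δ_{q+1}^{1/2}`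
      intro t ht x
      have e1 : v' t x = v t x + (v' t x - v t x) := by abel
      rw [e1]
      refine (norm_add_le _ _).trans ?_
      have k1 := hIE.velocity_le t ht x
      have k2 := hwsup t ht x
      linarith
    · -- (2.6) at `q+1`, lower bound, from (2.24c)
      intro t ht
      have habs := abs_le.1 (h62' t ht)
      have k1 : amp β a b (q + 1 + 1) * freq a b (q + 1) ^ (-α) ≤ amp β a b (q + 1 + 1) * (1 / 4) :=
        mul_le_mul_of_nonneg_left hU6 hA2.le
      linarith [habs.1]
    · -- (2.6) at `q+1`, upper bound, from (2.24c)
      intro t ht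
      have habs := abs_le.1 (h62' t ht)
      linarith [habs.2, hA2.le]
  exact ⟨v', p', R', hER', hIE', hVI⟩

end Assembly

end BDSV

end Literature.Analysis.FluidPDE
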